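import Literature.Computability.QuantumComplexity.StageAbstract
import Literature.Computability.Cryptography.RegevSamplerStageDesc
import HarnessLib

/-!
# Register-embedded stages of the Regev sampler, on codes

Topic `Computability/Cryptography`; stages S3/S4 (and the shape of S5) of the uniformity of the machine sampler of
[Regev2009, Lemma 3.14]. The Grover–Rudolph stage and the Fourier stage of `machineCircPar` abstract to
`(List.finRange n).flatMap fun i => blockWord.map (AGmap (embA off ℓ base B i))` (`map_toAG_grStage_std`,
`map_toAG_qftStage_std` in `RegevSamplerStageDesc.lean`). This file computes such a stage on codes from the block word and
the four numbers of the affine register embedding `embA` (`StageAbstract.stageA_codeFP` + `embA_codeFP_of`):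

* `finRange_flatMap_coe` — `(List.finRange n).flatMap (g ∘ val) = (List.range n).flatMap g`;
* **`stageEmbA_codeFP_of`** — from a context computing the block word, `n` (unary) and `off, ℓ, base, B` (binary), the
  embedded stage word is computed on codes in polynomial time.

What remains for S3/S4 is the block words themselves (`GRStage.blockCircuit`, `QFTStage.block`). Everything is proved;
no named fact is introduced.

## References

* O. Regev, *On lattices, learning with errors, random linear codes, and cryptography*, J. ACM 56(6) (2009), Lemma 3.14
  (proof: the registers) [Regev2009].
* S. Arora, B. Barak, *Computational Complexity: A Modern Approach*, CUP 2009, §6.2 and proof of Thm. 6.15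
  [AroraBarak2009].
-/

noncomputable section

namespace Literature.Computability.Cryptography.Regev2009.SamplerRegs

open _root_.Computability Literature.Computability.QuantumComplexity Literature.Computability.QuantumComplexity.AJLCore
  Literature.Computability.Complexity Literature.Computability.Complexity.CodeFP

/-- A flat map over `finRange` through the value is a flat map over `range`. [folklore] -/
theorem finRange_flatMap_coe {α : Type} (n : ℕ) (g : ℕ → List α) :
    ((List.finRange n).flatMap fun i : Fin n => g (i : ℕ)) = (List.range n).flatMap g := by
  simp only [← List.map_coe_finRange_eq_range, List.flatMap_map]

/-- **A register-embedded stage on codes**: the block word repeated over the `n` registers through the affine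
embeddings `embA off ℓ base B i`. [cite: Regev2009, Lemma 3.14 (proof: the registers)]
[cite: AroraBarak2009, §6.2 and proof of Thm. 6.15] -/
theorem stageEmbA_codeFP_of {σ : Type} {eσ : σ → List Bool} {Bw : σ → List AG} {n off ℓ base B : σ → ℕ}
    (hBw : CodeFP eσ (rawE agE0) Bw) (hn : CodeFP eσ unE n) (hoff : CodeFP eσ natE off) (hℓ : CodeFP eσ natE ℓ)
    (hbase : CodeFP eσ natE base) (hB : CodeFP eσ natE B) :
    CodeFP eσ (rawE agE0) (fun c => (List.finRange (n c)).flatMap fun i : Fin (n c) =>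
      (Bw c).map (AGmap (embA (off c) (ℓ c) (base c) (B c) (i : ℕ)))) := by
  have h := (stageA_codeFP (f := fun c i w => embA (off c) (ℓ c) (base c) (B c) i w) hBw (natOfUn.comp hn)
    (embA_codeFP_of hoff hℓ hbase hB)).comp (hn.pair (CodeFP.id _))
  refine h.congr fun c => ?_
  show ((List.range (min (n c) (n c))).flatMap fun i => (Bw c).map (AGmap (embA (off c) (ℓ c) (base c) (B c) i))) = _
  rw [min_self, ← finRange_flatMap_coe]

end Literature.Computability.Cryptography.Regev2009.SamplerRegs

end
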